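import Literature.NumberTheory.Automorphic.UnitaryGroupCharpolyBorelClasses
import HarnessLib

/-!
# The two rational Borels through a regular hyperbolic element of `U(J₂)(F)` — the rank-one
# (`H`-side) copy of the hyperbolic Borel slice
(Rogawski, *Automorphic Representations of Unitary Groups in Three Variables* (1990), §1.9–§1.10 (the
quasi-split unitary groups `U(Φ_N)`, `B = MN`), §3.6 pp. 28–29 (the centraliser of a regular element of `M` is
`M`), §6.1 pp. 79–80: «Let `γ` be a regular element in `M` … `J^T_𝔬(f)` can be expressed as a weighted orbital
integral … `W(g) = 2T − H(g) − H(wg)`», `w` the non-trivial element of `Ω(M)`; §7.3 pp. 97–98 (the same terms for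
`H = U(2) × U(1)`); Arthur, *A trace formula for reductive groups I*, Duke Math. J. 45 (1978), §8: a regular
class meets `P(F)` along `{γ, γ^w}·N(F)` and each of its elements lies in exactly the parabolics `P^δ`,
`P^{wδ}`.)

Topic `NumberTheory/Automorphic`; namespace `Literature.NumberTheory.Automorphic.UnitaryGroup`. THEOREMS
ONLY over accepted tree modules: no definition, no named fact, no instance, no notation, no `sorry`. Item
(σ-h-1) of the `H`-side copy of LAWS 1–5 (census `CENSUS-LAWS-Hside` §3 LAW 5 (σ-h), sibling #1) of the T1-qs
road of `Cruxes/H413/Lines/F0_T1InnerFormTraceIdentity.lean` (cell `pub/hodgecm-mathlib`, crux H413): the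
`N = 2` twin of ★ `UnitaryGroupHyperbolicBorelSlice` §§1–7. For a quadratic `E/F` with involution `c`
(`c² = 1`) and the quasi-split `G = U(J₂)`, `B = T·N` upper triangular, `T = {d(α, ᾱ⁻¹)}`, a regular hyperbolic
`γ₀ = d(a, (c a)⁻¹)` (`c a · a ≠ 1`, class (ii) of ★ `meetsBorel_dichotomy`) and the Weyl element
`w = J₂ = antidiag(1, 1)`: each `γ′ = δ⁻¹γ₀δ` lies in EXACTLY TWO rational Borel subgroups, `δ⁻¹Bδ` and
`δ⁻¹w⁻¹Bwδ`, so the correction term of `k^T_𝔬(x)` regroups with Arthur's weight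
`u_T(δx) = 1 − 1_{T<H(δx)} − 1_{T<H(wδx)}`. Everything is 2 × 2 linear algebra; no measure theory.

The hyperbolic torus point is the HYPOTHESIS `hg₀ : (g₀ : Matrix) = !![a, 0; 0, (c a)⁻¹]` and the Weyl element
the HYPOTHESIS `hw : (w : Matrix) = !![0, 1; 1, 0]` on rational elements (existence:
`exists_rational_eq_hyperbolicDiagonal_two`, `exists_rational_eq_weyl_two`) — no definition introduced.

* §1 **`offDiag_eq_zero_of_commute_diagonal_two`** (REGULAR RIGIDITY, 2 × 2: the centraliser of a regular
  diagonal is diagonal).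
* §2 **`exists_rational_eq_weyl_two`** (`w = J₂ ∈ U(J₂)(F)`), `weyl_mul_self_two`, `weyl_inv_two`,
  **`coe_weyl_conj_diagonal_two`** (`w d(τ₀,τ₁) w⁻¹ = d(τ₁,τ₀)`: the second torus point `γ₀^w`),
  `not_blockTriangular_weyl_two`, `toAdelic_weyl_not_mem_borelAdelic_two` (`w ∉ B`).
* §3 `diag_relations_of_blockTriangular_two`, **`diag_eq_or_of_blockTriangular_of_charpoly_eq_hyperbolic_two`**
  — a rational BOREL element of the class has diagonal `(a, (ca)⁻¹)` or `((ca)⁻¹, a)` («`𝔬 ∩ M = {γ₀, γ₀^w}`»).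
* §4 the RATIONAL TWIST in ONE step: **`exists_unipotent_conj_eq_diagonal_two`** — a Borel element with
  regular diagonal `τ₀ ≠ τ₁` is `N(F)`-conjugate to its diagonal (the conjugating `n(s)`, `s = x∕(τ₀ − τ₁)`,
  is unitary because `c s = −s` follows from the unitarity of `β`).
* §5 `mem_borelOfForm_of_blockTriangular_two`, **`blockTriangular_of_commute_regular_two`** (`G_{γ₀}(F) = T(F)
  ≤ B(F)`), **`conj_mem_borel_iff_of_hyperbolic_two`**: `h γ₀ h⁻¹ ∈ B(F) ↔ h ∈ B(F) ∨ h w ∈ B(F)`.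
* §6 (letters of `G(F) ≤ G(𝔸_F)`, `γ♯ = ι(γ₀)`, `w♯ = ι(w)`) **`conj_mem_arithmeticBorel_iff_of_hyperbolic_two`**,
  **`mem_arithmeticBorel_of_commute_hyperbolic_two`**, `mk_toAdelic_weyl_not_mem_arithmeticBorel_two`,
  `mk_toAdelic_weyl_mul_self_two`, **`out_conj_mem_arithmeticBorel_iff_of_hyperbolic_two`** (for
  `γ′ = δ₀⁻¹γ♯δ₀` and a right coset `q ∈ B(F)∖G(F)`: `q.out γ′ q.out⁻¹ ∈ B(F) ↔ q = B(F)δ₀ ∨ q = B(F)w♯δ₀`),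
  **`mk_ne_mk_weyl_mul_two`** (the two cosets are distinct).
* §7 `exists_rational_eq_hyperbolicDiagonal_two`, `exists_unipotent_conj_eq_or_of_hyperbolic_two`, and
  **`exists_conj_eq_mk_toAdelic_of_conj_mem_arithmeticBorel_two`** — an element of `G(F)` of the class
  `((X − a)(X − (ca)⁻¹)) ⊗ 𝔸_E` that is `G(F)`-conjugate INTO `B(F)` is `G(F)`-conjugate to `γ♯` (the «into
  `B(F)`» input is the `N = 2` «classes meeting `B(F)` live in rational Borels» letter of the sequel files).

## References

* J. D. Rogawski, *Automorphic Representations of Unitary Groups in Three Variables*, Annals of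
  Mathematics Studies 123 (1990), §1.9–§1.10, §3.6 (pp. 28–29), §6.1 (pp. 79–80), §7.3 (pp. 97–98) [Rogawski1990].
* J. Arthur, *A trace formula for reductive groups I: terms associated to classes in `G(ℚ)`*, Duke
  Math. J. 45 (1978), §8 [Arthur1978TraceFormulaI].
-/

set_option autoImplicit false

noncomputable section

open NumberField IsDedekindDomain Matrix Polynomial
open scoped Classical MatrixGroups

namespace Literature.NumberTheory.Automorphic

namespace UnitaryGroup

/-! ## §1 Regular rigidity: the centraliser of a regular `2 × 2` diagonal matrix is diagonal (any field) -/

section Regular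

variable {E : Type} [Field E]

/-- **REGULAR RIGIDITY** (`2 × 2`): a matrix commuting with a diagonal matrix with distinct entries
`(τ₀, τ₁)` is diagonal (`h₀₁ = h₁₀ = 0`; entrywise `(τ₁ − τ₀) h₀₁ = 0`) — the centraliser of a regular element
of the maximal torus `M` of `U(2)` is `M`. [cite: Rogawski1990, §3.6 (pp. 28–29)] -/
theorem offDiag_eq_zero_of_commute_diagonal_two {τ₀ τ₁ : E} (h01 : τ₀ ≠ τ₁)
    {h : Matrix (Fin 2) (Fin 2) E} (heq : h * !![τ₀, 0; 0, τ₁] = !![τ₀, 0; 0, τ₁] * h) :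
    h 0 1 = 0 ∧ h 1 0 = 0 := by
  have e01 := congrFun (congrFun heq 0) 1
  have e10 := congrFun (congrFun heq 1) 0
  simp [Matrix.mul_apply, Fin.sum_univ_two] at e01 e10
  refine ⟨?_, ?_⟩
  · have h0 : (τ₁ - τ₀) * h 0 1 = 0 := by linear_combination e01
    exact (mul_eq_zero.1 h0).resolve_left (sub_ne_zero.2 h01.symm)
  · have h0 : (τ₀ - τ₁) * h 1 0 = 0 := by linear_combination e10
    exact (mul_eq_zero.1 h0).resolve_left (sub_ne_zero.2 h01)

end Regular

/-! ## §2 The Weyl element `w = J₂` of `U(J₂)(F)` -/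

section Weyl

variable {F E : Type} [Field F] [NumberField F] [Field E] [NumberField E] [Algebra F E]
  {c : E ≃ₐ[F] E}

/-- `rev 1 = 0` in `Fin 2`. [folklore] -/
private theorem rev1₂ : Fin.rev (1 : Fin 2) = 0 := rfl

omit [NumberField E] in
/-- `det J₂ = -1 ≠ 0`. [folklore] -/
private theorem det_weyl_two_ne_zero : (!![(0 : E), 1; 1, 0] : Matrix (Fin 2) (Fin 2) E).det ≠ 0 := by
  rw [Matrix.det_fin_two]; simp

/-- **The Weyl element `w = J₂ = antidiag(1,1)` lies in `U(J₂)(F)`** (`ᵗ(cJ) J J = J³ = J`): the non-trivial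
element of the Weyl group `Ω(M)` of the rank-one torus, `w d(α,β) w⁻¹ = d(β,α)`. [cite: Rogawski1990, §6.1 (p. 80)] -/
theorem exists_rational_eq_weyl_two :
    ∃ w : (quasiSplit F E c 2).Rational, ((w.1 : GL (Fin 2) E) : Matrix (Fin 2) (Fin 2) E) = !![(0 : E), 1; 1, 0] := by
  refine ⟨⟨Matrix.GeneralLinearGroup.mkOfDetNeZero _ det_weyl_two_ne_zero, ?_⟩,
    Matrix.GeneralLinearGroup.val_mkOfDetNeZero _ _⟩
  change Matrix.GeneralLinearGroup.mkOfDetNeZero _ det_weyl_two_ne_zero ∈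
    unitaryGroupOfForm (c : E →+* E) ((StdForm.antidiagonal 2).over E)
  rw [mem_unitaryGroupOfForm_antidiagonal_iff_sum']
  intro i j
  fin_cases i <;> fin_cases j <;>
    simp [Fin.sum_univ_two, rev1₂, Matrix.GeneralLinearGroup.val_mkOfDetNeZero]

/-- `w² = 1`. [cite: Rogawski1990, §6.1 (p. 80)] -/
theorem weyl_mul_self_two {w : (quasiSplit F E c 2).Rational}
    (hw : ((w.1 : GL (Fin 2) E) : Matrix (Fin 2) (Fin 2) E) = !![(0 : E), 1; 1, 0]) : w * w = 1 := by
  apply Subtype.ext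
  apply Matrix.GeneralLinearGroup.ext
  intro i j
  change (((w.1 : GL (Fin 2) E) * (w.1 : GL (Fin 2) E) : GL (Fin 2) E) : Matrix (Fin 2) (Fin 2) E) i j =
    ((1 : GL (Fin 2) E) : Matrix (Fin 2) (Fin 2) E) i j
  rw [Units.val_mul, hw, Units.val_one]
  fin_cases i <;> fin_cases j <;> simp [Matrix.mul_apply, Fin.sum_univ_two]

/-- `w⁻¹ = w`. [cite: Rogawski1990, §6.1 (p. 80)] -/
theorem weyl_inv_two {w : (quasiSplit F E c 2).Rational}
    (hw : ((w.1 : GL (Fin 2) E) : Matrix (Fin 2) (Fin 2) E) = !![(0 : E), 1; 1, 0]) : w⁻¹ = w :=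
  inv_eq_of_mul_eq_one_right (weyl_mul_self_two hw)

/-- **`w` swaps the diagonal**: `w · !![τ₀,0;0,τ₁] · w⁻¹ = !![τ₁,0;0,τ₀]` — for `γ₀ = d(a, (ca)⁻¹)` this is
the second torus point `γ₀^w = d((ca)⁻¹, a)` of its class. [cite: Rogawski1990, §6.1 (p. 80)] -/
theorem coe_weyl_conj_diagonal_two {w g : (quasiSplit F E c 2).Rational}
    (hw : ((w.1 : GL (Fin 2) E) : Matrix (Fin 2) (Fin 2) E) = !![(0 : E), 1; 1, 0]) {τ₀ τ₁ : E}
    (hg : ((g.1 : GL (Fin 2) E) : Matrix (Fin 2) (Fin 2) E) = !![τ₀, 0; 0, τ₁]) :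
    (((w * g * w⁻¹).1 : GL (Fin 2) E) : Matrix (Fin 2) (Fin 2) E) = !![τ₁, 0; 0, τ₀] := by
  rw [weyl_inv_two hw]
  change (((w.1 : GL (Fin 2) E) * (g.1 : GL (Fin 2) E) * (w.1 : GL (Fin 2) E) : GL (Fin 2) E) :
      Matrix (Fin 2) (Fin 2) E) = _
  rw [Units.val_mul, Units.val_mul, hw, hg]
  ext i j
  fin_cases i <;> fin_cases j <;> simp [Matrix.mul_apply, Fin.sum_univ_two]

/-- **`w ∉ B(F)`**: `w` is not upper triangular. [cite: Rogawski1990, §6.1 (p. 80)] -/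
theorem not_blockTriangular_weyl_two {w : (quasiSplit F E c 2).Rational}
    (hw : ((w.1 : GL (Fin 2) E) : Matrix (Fin 2) (Fin 2) E) = !![(0 : E), 1; 1, 0]) :
    ¬ (((w.1 : GL (Fin 2) E) : Matrix (Fin 2) (Fin 2) E)).BlockTriangular id := by
  intro h
  have h10 : ((w.1 : GL (Fin 2) E) : Matrix (Fin 2) (Fin 2) E) 1 0 = 0 := h (show ((0 : Fin 2) : Fin 2) < 1 by decide)
  rw [hw] at h10
  simp at h10

/-- `ι(w) ∉ B(𝔸_F)`, so its image in `G(F)` is not in `B(F)`. [cite: Rogawski1990, §6.1 (p. 80)] -/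
theorem toAdelic_weyl_not_mem_borelAdelic_two {w : (quasiSplit F E c 2).Rational}
    (hw : ((w.1 : GL (Fin 2) E) : Matrix (Fin 2) (Fin 2) E) = !![(0 : E), 1; 1, 0]) :
    (quasiSplit F E c 2).toAdelic w ∉ borelAdelic F E c 2 := fun h =>
  not_blockTriangular_weyl_two hw ((toAdelic_mem_borelAdelic_iff w).1 h)

end Weyl

/-! ## §3 The diagonal of a Borel element of the regular hyperbolic class -/

section Diagonal

variable {F E : Type} [Field F] [NumberField F] [Field E] [NumberField E] [Algebra F E]
  {c : E ≃ₐ[F] E}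

omit [NumberField F] [NumberField E] in
/-- `c (c x) = x` for an involution `c`. [folklore] -/
private theorem conj_conj₂ (hc : c * c = 1) (x : E) : c (c x) = x := by
  rw [← AlgEquiv.mul_apply, hc, AlgEquiv.one_apply]

omit [NumberField F] [NumberField E] in
/-- For `c a · a ≠ 1` the two roots `a`, `(c a)⁻¹` are distinct. [cite: Rogawski1990, §3.6 (pp. 28–29)] -/
private theorem ne_inv_conj_of_ne {a : Eˣ} (ha : c (a : E) * (a : E) ≠ 1) :
    (a : E) ≠ (c (a : E))⁻¹ := by
  have ha0 : c (a : E) ≠ 0 := by rw [map_ne_zero_iff _ c.injective]; exact a.ne_zero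
  intro h
  apply ha
  have : c (a : E) * (c (a : E))⁻¹ = 1 := mul_inv_cancel₀ ha0
  rwa [← h] at this

/-- The two unitarity relations of the diagonal of an upper triangular `β ∈ U(J₂)(F)`:
`c(β₁₁) β₀₀ = 1`, `c(β₀₀) β₁₁ = 1` (its Levi part lies in `T(F)`). [cite: Rogawski1990, §1.10] -/
theorem diag_relations_of_blockTriangular_two {β : (quasiSplit F E c 2).Rational}
    (hB : (((β.1 : GL (Fin 2) E) : Matrix (Fin 2) (Fin 2) E)).BlockTriangular id) :
    c (((β.1 : GL (Fin 2) E) : Matrix (Fin 2) (Fin 2) E) 1 1) * ((β.1 : GL (Fin 2) E) : Matrix (Fin 2) (Fin 2) E) 0 0 = 1 ∧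
    c (((β.1 : GL (Fin 2) E) : Matrix (Fin 2) (Fin 2) E) 0 0) * ((β.1 : GL (Fin 2) E) : Matrix (Fin 2) (Fin 2) E) 1 1 = 1 := by
  obtain ⟨u, -, d, hdT, hd, -⟩ :=
    exists_unipotent_mul_torus_of_mem_borelOfForm (σ := (c : E →+* E)) (N := 2) (b := (β.1 : GL (Fin 2) E)) ⟨β.2, hB⟩
  have hrel : ∀ i, c (d (Fin.rev i) : E) * (d i : E) = 1 := by
    have h := (glDiagonal_mem_unitaryGroupOfForm_antidiagonal_iff (c : E →+* E) 2 d).1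
      (torusOfForm_le_borelOfForm hdT).1
    intro i
    have hi := h i
    rwa [RingHom.coe_coe] at hi
  refine ⟨?_, ?_⟩
  · rw [← hd 0, ← hd 1]; exact hrel 0
  · rw [← hd 0, ← hd 1]; exact hrel 1

omit [NumberField E] in
/-- A root of `(X − a)(X − d)` is `a` or `d`. [folklore] -/
private theorem eq_or_eq_of_eval_eq_zero {a d x : E} (h : ((X - C a) * (X - C d)).eval x = 0) :
    x = a ∨ x = d := by
  simp only [eval_mul, eval_sub, eval_X, eval_C, mul_eq_zero, sub_eq_zero] at h
  exact h

/-- **The diagonal of a rational Borel element of the regular hyperbolic class is `(a, (ca)⁻¹)` or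
`((ca)⁻¹, a)`**: for `β ∈ U(J₂)(F)` upper triangular with characteristic polynomial `(X − a)(X − (ca)⁻¹)`
(no regularity needed at rank one) — the two elements `γ₀ = d(a, ā⁻¹)`, `γ₀^w` of `𝔬 ∩ M`. [cite: Rogawski1990, §6.1 (pp. 79–80); §7.3 (p. 97)] -/
theorem diag_eq_or_of_blockTriangular_of_charpoly_eq_hyperbolic_two (hc : c * c = 1) {a : Eˣ}
    {β : (quasiSplit F E c 2).Rational}
    (hB : (((β.1 : GL (Fin 2) E) : Matrix (Fin 2) (Fin 2) E)).BlockTriangular id)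
    (hp : (((β.1 : GL (Fin 2) E) : Matrix (Fin 2) (Fin 2) E)).charpoly = (X - C (a : E)) * (X - C (c (a : E))⁻¹)) :
    (((β.1 : GL (Fin 2) E) : Matrix (Fin 2) (Fin 2) E) 0 0 = a ∧
      ((β.1 : GL (Fin 2) E) : Matrix (Fin 2) (Fin 2) E) 1 1 = (c (a : E))⁻¹) ∨
    (((β.1 : GL (Fin 2) E) : Matrix (Fin 2) (Fin 2) E) 0 0 = (c (a : E))⁻¹ ∧
      ((β.1 : GL (Fin 2) E) : Matrix (Fin 2) (Fin 2) E) 1 1 = a) := by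
  have ha0 : c (a : E) ≠ 0 := by rw [map_ne_zero_iff _ c.injective]; exact a.ne_zero
  obtain ⟨hrel0, hrel1⟩ := diag_relations_of_blockTriangular_two hB
  set τ₀ := ((β.1 : GL (Fin 2) E) : Matrix (Fin 2) (Fin 2) E) 0 0 with hτ₀
  set τ₁ := ((β.1 : GL (Fin 2) E) : Matrix (Fin 2) (Fin 2) E) 1 1 with hτ₁
  -- the characteristic polynomial of the upper triangular `β` is `(X − τ₀)(X − τ₁)`
  have hchar : (X - C τ₀) * (X - C τ₁) = (X - C (a : E)) * (X - C (c (a : E))⁻¹) := by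
    rw [← hp, Matrix.charpoly_of_upperTriangular _ hB, Fin.prod_univ_two]
  -- `τ₀` is a root
  have root : τ₀ = a ∨ τ₀ = (c (a : E))⁻¹ := by
    apply eq_or_eq_of_eval_eq_zero
    rw [← hchar]
    simp
  -- `τ₁ = (c τ₀)⁻¹`
  have hτ₁v : τ₁ = (c τ₀)⁻¹ := eq_inv_of_mul_eq_one_right hrel1
  rcases root with h0 | h0
  · refine Or.inl ⟨h0, ?_⟩
    rw [hτ₁v, h0]
  · refine Or.inr ⟨h0, ?_⟩
    rw [hτ₁v, h0, map_inv₀, conj_conj₂ hc, inv_inv]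

end Diagonal

/-! ## §4 `N(F)`-conjugation of a Borel element with regular diagonal onto its diagonal (the rational twist) -/

section Twist

variable {F E : Type} [Field F] [NumberField F] [Field E] [NumberField E] [Algebra F E]
  {c : E ≃ₐ[F] E}

/-- **THE RATIONAL TWIST, rank one** (`α = τ₀∕τ₁ ≠ 1`): an upper triangular `β = !![τ₀, x; 0, τ₁] ∈ U(J₂)(F)`
with `τ₀ ≠ τ₁` is conjugate by an element `n(s) = !![1, s; 0, 1]` of `N(F)` (`s = x∕(τ₀ − τ₁)`, and `c s = −s`
by the unitarity of `β`) to its diagonal `d(τ₀, τ₁)` — one step instead of the two of the `U(3)` twist.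
[cite: Rogawski1990, §6.1 (pp. 79–80); §7.3 (p. 97)] -/
theorem exists_unipotent_conj_eq_diagonal_two {β : (quasiSplit F E c 2).Rational} {τ₀ τ₁ x : E}
    (hβ : ((β.1 : GL (Fin 2) E) : Matrix (Fin 2) (Fin 2) E) = !![τ₀, x; 0, τ₁]) (h01 : τ₀ ≠ τ₁) :
    ∃ u : (quasiSplit F E c 2).Rational, (u.1 : GL (Fin 2) E) ∈ unipotentOfForm (c : E →+* E) 2 ∧
      (((u * β * u⁻¹).1 : GL (Fin 2) E) : Matrix (Fin 2) (Fin 2) E) = !![τ₀, 0; 0, τ₁] := by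
  have hB : (((β.1 : GL (Fin 2) E) : Matrix (Fin 2) (Fin 2) E)).BlockTriangular id := by
    rw [hβ]; intro i j hij; fin_cases i <;> fin_cases j <;> simp_all
  obtain ⟨hrel0, hrel1⟩ := diag_relations_of_blockTriangular_two hB
  rw [hβ] at hrel0 hrel1
  simp at hrel0 hrel1
  -- the `(1,1)` unitarity relation `c(x) τ₁ + c(τ₁) x = 0`
  have hU := (mem_unitaryGroupOfForm_antidiagonal_iff_sum' (c : E →+* E) 2 (β.1 : GL (Fin 2) E)).1 β.2
  have hx := hU 1 1
  rw [hβ] at hx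
  simp [Fin.sum_univ_two, rev1₂] at hx
  -- parameters
  have h01' : τ₀ - τ₁ ≠ 0 := sub_ne_zero.2 h01
  obtain ⟨s, hs⟩ : ∃ s : E, s * (τ₀ - τ₁) = x := ⟨x / (τ₀ - τ₁), div_mul_cancel₀ x h01'⟩
  have hcs : c s * (c τ₀ - c τ₁) = c x := by rw [← map_sub, ← map_mul, hs]
  have hcsneg : c s = -s := by
    have h3 : (c s + s) * (τ₀ - τ₁) = 0 := by
      linear_combination (τ₀ * τ₁) * hcs - (c s * τ₀) * hrel1 + (c s * τ₁ - x) * hrel0 + τ₀ * hx + hs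
    linear_combination (mul_eq_zero.1 h3).resolve_right h01'
  have hUdet : (!![(1 : E), s; 0, 1] : Matrix (Fin 2) (Fin 2) E).det ≠ 0 := by
    rw [Matrix.det_fin_two]; simp
  have hUunit : Matrix.GeneralLinearGroup.mkOfDetNeZero _ hUdet ∈
      unitaryGroupOfForm (c : E →+* E) ((StdForm.antidiagonal 2).over E) := by
    rw [mem_unitaryGroupOfForm_antidiagonal_iff_sum']
    intro i j
    fin_cases i <;> fin_cases j <;>
      simp [Fin.sum_univ_two, rev1₂, Matrix.GeneralLinearGroup.val_mkOfDetNeZero, hcsneg]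
  refine ⟨⟨Matrix.GeneralLinearGroup.mkOfDetNeZero _ hUdet, hUunit⟩,
    mem_unipotentOfForm_iff.2 ⟨hUunit, (mem_upperUnitriangular_iff _).2 ⟨?_, ?_⟩⟩, ?_⟩
  · rw [Matrix.GeneralLinearGroup.val_mkOfDetNeZero]
    intro i j hij
    fin_cases i <;> fin_cases j <;> simp_all
  · rw [Matrix.GeneralLinearGroup.val_mkOfDetNeZero]
    intro i
    fin_cases i <;> simp
  · have key : !![(1 : E), s; 0, 1] * !![τ₀, x; 0, τ₁] = !![τ₀, 0; 0, τ₁] * !![(1 : E), s; 0, 1] := by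
      ext i j
      fin_cases i <;> fin_cases j <;> simp [Matrix.mul_apply, Fin.sum_univ_two]
      · linear_combination -hs
    have hinv : !![(1 : E), s; 0, 1] * (!![(1 : E), s; 0, 1])⁻¹ = 1 :=
      Matrix.mul_nonsing_inv _ (Ne.isUnit hUdet)
    change (((Matrix.GeneralLinearGroup.mkOfDetNeZero _ hUdet * (β.1 : GL (Fin 2) E) *
        (Matrix.GeneralLinearGroup.mkOfDetNeZero _ hUdet)⁻¹ : GL (Fin 2) E)) : Matrix (Fin 2) (Fin 2) E) = _
    rw [Units.val_mul, Units.val_mul, Matrix.coe_units_inv, Matrix.GeneralLinearGroup.val_mkOfDetNeZero, hβ, key,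
      Matrix.mul_assoc, hinv, Matrix.mul_one]

end Twist

/-! ## §5 The two rational Borels through `γ₀`: `{h ∈ G(F) ∣ h γ₀ h⁻¹ ∈ B(F)} = B(F) ⊔ B(F)·w` -/

section TwoBorels

variable {F E : Type} [Field F] [NumberField F] [Field E] [NumberField E] [Algebra F E]
  {c : E ≃ₐ[F] E}

/-- A rational element whose matrix is upper triangular lies in the Borel subgroup `borelOfForm`
(`N = 2`). [cite: Rogawski1990, §1.10] -/
theorem mem_borelOfForm_of_blockTriangular_two {h : (quasiSplit F E c 2).Rational}
    (hB : (((h.1 : GL (Fin 2) E) : Matrix (Fin 2) (Fin 2) E)).BlockTriangular id) :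
    (h.1 : GL (Fin 2) E) ∈ borelOfForm (c : E →+* E) 2 := ⟨h.2, hB⟩

/-- **An element of `U(J₂)(F)` commuting with a regular diagonal `γ₀ = d(τ₀, τ₁)`, `τ₀ ≠ τ₁`, is diagonal**,
in particular upper triangular: the centraliser `G_{γ₀}(F) = T(F) ≤ B(F)`. [cite: Rogawski1990, §3.6 (pp. 28–29)] -/
theorem blockTriangular_of_commute_regular_two {g₀ h : (quasiSplit F E c 2).Rational} {τ₀ τ₁ : E}
    (hg₀ : ((g₀.1 : GL (Fin 2) E) : Matrix (Fin 2) (Fin 2) E) = !![τ₀, 0; 0, τ₁])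
    (h01 : τ₀ ≠ τ₁) (hcomm : h * g₀ = g₀ * h) :
    (((h.1 : GL (Fin 2) E) : Matrix (Fin 2) (Fin 2) E)).BlockTriangular id ∧
      ((h.1 : GL (Fin 2) E) : Matrix (Fin 2) (Fin 2) E) 0 1 = 0 := by
  have heq : ((h.1 : GL (Fin 2) E) : Matrix (Fin 2) (Fin 2) E) * !![τ₀, 0; 0, τ₁] =
      !![τ₀, 0; 0, τ₁] * ((h.1 : GL (Fin 2) E) : Matrix (Fin 2) (Fin 2) E) := by
    rw [← hg₀, ← Units.val_mul, ← Units.val_mul]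
    exact congrArg (fun x : (quasiSplit F E c 2).Rational => ((x.1 : GL (Fin 2) E) : Matrix (Fin 2) (Fin 2) E)) hcomm
  obtain ⟨h01', h10⟩ := offDiag_eq_zero_of_commute_diagonal_two h01 heq
  refine ⟨?_, h01'⟩
  intro i j hij
  fin_cases i <;> fin_cases j <;> simp_all

/-- **THE TWO RATIONAL BORELS THROUGH A REGULAR HYPERBOLIC ELEMENT** (rank one). For
`γ₀ = d(a, (ca)⁻¹) ∈ T(F)` regular hyperbolic (`c a · a ≠ 1`), `w` the Weyl element and `h ∈ U(J₂)(F)`: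
`h γ₀ h⁻¹ ∈ B(F) ↔ h ∈ B(F) ∨ h·w ∈ B(F)` — `γ₀^h` lies in exactly the two Borel subgroups through the torus,
`B ⊃ T` and `B^w ⊃ T`, the input of the weighted-orbital-integral regrouping of `k^T_𝔬`
[Rogawski1990, §6.1 (6.1.1)–(6.1.3): `W(g) = 2T − H(g) − H(wg)`; Arthur 1978 §8]. Proof: `⇐` by the diagonal
form of `w γ₀ w⁻¹`; `⇒` by §3–§4 (`N(F)`-conjugation of `h γ₀ h⁻¹ ∈ B(F)` to `γ₀` or `γ₀^w`) and the regular
rigidity of §1. [cite: Rogawski1990, §6.1 (pp. 79–80); §7.3 (p. 97)] [cite: Arthur1978TraceFormulaI, §8] -/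
theorem conj_mem_borel_iff_of_hyperbolic_two (hc : c * c = 1) {a : Eˣ} (ha : c (a : E) * (a : E) ≠ 1)
    {g₀ w h : (quasiSplit F E c 2).Rational}
    (hg₀ : ((g₀.1 : GL (Fin 2) E) : Matrix (Fin 2) (Fin 2) E) = !![(a : E), 0; 0, (c (a : E))⁻¹])
    (hw : ((w.1 : GL (Fin 2) E) : Matrix (Fin 2) (Fin 2) E) = !![(0 : E), 1; 1, 0]) :
    ((((h * g₀ * h⁻¹).1 : GL (Fin 2) E) : Matrix (Fin 2) (Fin 2) E)).BlockTriangular id ↔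
      (((h.1 : GL (Fin 2) E) : Matrix (Fin 2) (Fin 2) E)).BlockTriangular id ∨
      ((((h * w).1 : GL (Fin 2) E) : Matrix (Fin 2) (Fin 2) E)).BlockTriangular id := by
  have haa' := ne_inv_conj_of_ne (F := F) ha
  have hg₀B : (g₀.1 : GL (Fin 2) E) ∈ borelOfForm (c : E →+* E) 2 :=
    mem_borelOfForm_of_blockTriangular_two (by rw [hg₀]; intro i j hij; fin_cases i <;> fin_cases j <;> simp_all)
  -- `w γ₀ w⁻¹ = d((ca)⁻¹, a)` is diagonal, hence in `B(F)`
  have hwg := coe_weyl_conj_diagonal_two hw hg₀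
  have hwg₀B : ((w * g₀ * w⁻¹).1 : GL (Fin 2) E) ∈ borelOfForm (c : E →+* E) 2 :=
    mem_borelOfForm_of_blockTriangular_two (by rw [hwg]; intro i j hij; fin_cases i <;> fin_cases j <;> simp_all)
  constructor
  · intro hβB
    -- the characteristic polynomial of the conjugate
    have hp : ((((h * g₀ * h⁻¹).1 : GL (Fin 2) E) : Matrix (Fin 2) (Fin 2) E)).charpoly =
        (X - C (a : E)) * (X - C (c (a : E))⁻¹) := by
      change ((((h.1 : GL (Fin 2) E) * (g₀.1 : GL (Fin 2) E) * (h.1 : GL (Fin 2) E)⁻¹ : GL (Fin 2) E)) :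
        Matrix (Fin 2) (Fin 2) E).charpoly = _
      rw [Units.val_mul, Units.val_mul, Matrix.coe_units_inv, Matrix.charpoly_units_conj, hg₀,
        Matrix.charpoly_of_upperTriangular _ (by intro i j hij; fin_cases i <;> fin_cases j <;> simp_all),
        Fin.prod_univ_two]
      simp
    rcases diag_eq_or_of_blockTriangular_of_charpoly_eq_hyperbolic_two hc hβB hp with ⟨h00, h11⟩ | ⟨h00, h11⟩
    · -- diagonal `(a, (ca)⁻¹)`: conjugate into `γ₀` itself
      left
      set β := h * g₀ * h⁻¹ with hβdef
      have hβmat : ((β.1 : GL (Fin 2) E) : Matrix (Fin 2) (Fin 2) E) =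
          !![(a : E), ((β.1 : GL (Fin 2) E) : Matrix (Fin 2) (Fin 2) E) 0 1; 0, (c (a : E))⁻¹] := by
        have h10 : ((β.1 : GL (Fin 2) E) : Matrix (Fin 2) (Fin 2) E) 1 0 = 0 := hβB (show ((0 : Fin 2) : Fin 2) < 1 by decide)
        ext i j; fin_cases i <;> fin_cases j <;> simp [h00, h11, h10]
      obtain ⟨u, hu, huβ⟩ := exists_unipotent_conj_eq_diagonal_two hβmat haa'
      -- `u` conjugates `β` to `γ₀`, so `u h` commutes with `γ₀`
      have hηβ : u * β * u⁻¹ = g₀ := by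
        apply Subtype.ext
        apply Units.ext
        rw [huβ, hg₀]
      have hcomm : (u * h) * g₀ = g₀ * (u * h) := by
        have : u * h * g₀ = (u * β * u⁻¹) * (u * h) := by rw [hβdef]; group
        rw [this, hηβ]
      have hηhB := (blockTriangular_of_commute_regular_two hg₀ haa' hcomm).1
      -- `h = u⁻¹ · (u h)` with both factors in `B(F)`
      have hmem : (h.1 : GL (Fin 2) E) ∈ borelOfForm (c : E →+* E) 2 := by
        have : h = u⁻¹ * (u * h) := by group
        rw [this]
        exact Subgroup.mul_mem _ (Subgroup.inv_mem _ (unipotentOfForm_le_borelOfForm hu))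
          (mem_borelOfForm_of_blockTriangular_two hηhB)
      exact hmem.2
    · -- diagonal `((ca)⁻¹, a)`: conjugate into `w γ₀ w⁻¹`
      right
      set β := h * g₀ * h⁻¹ with hβdef
      have hβmat : ((β.1 : GL (Fin 2) E) : Matrix (Fin 2) (Fin 2) E) =
          !![(c (a : E))⁻¹, ((β.1 : GL (Fin 2) E) : Matrix (Fin 2) (Fin 2) E) 0 1; 0, (a : E)] := by
        have h10 : ((β.1 : GL (Fin 2) E) : Matrix (Fin 2) (Fin 2) E) 1 0 = 0 := hβB (show ((0 : Fin 2) : Fin 2) < 1 by decide)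
        ext i j; fin_cases i <;> fin_cases j <;> simp [h00, h11, h10]
      obtain ⟨u, hu, huβ⟩ := exists_unipotent_conj_eq_diagonal_two hβmat haa'.symm
      have hηβ : u * β * u⁻¹ = w * g₀ * w⁻¹ := by
        apply Subtype.ext
        apply Units.ext
        rw [huβ, hwg]
      -- `d := w⁻¹ u h` commutes with `γ₀`
      have hcomm : (w⁻¹ * u * h) * g₀ = g₀ * (w⁻¹ * u * h) := by
        have : w⁻¹ * u * h * g₀ = w⁻¹ * (u * β * u⁻¹) * w * (w⁻¹ * u * h) := by
          rw [hβdef]; group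
        rw [this, hηβ]
        group
      have hd := blockTriangular_of_commute_regular_two hg₀ haa' hcomm
      -- the diagonal matrix of `d`
      set d := w⁻¹ * u * h with hddef
      have hdmat : ((d.1 : GL (Fin 2) E) : Matrix (Fin 2) (Fin 2) E) =
          !![((d.1 : GL (Fin 2) E) : Matrix (Fin 2) (Fin 2) E) 0 0, 0; 0, ((d.1 : GL (Fin 2) E) : Matrix (Fin 2) (Fin 2) E) 1 1] := by
        obtain ⟨hdB, hd01⟩ := hd
        have hd10 : ((d.1 : GL (Fin 2) E) : Matrix (Fin 2) (Fin 2) E) 1 0 = 0 := hdB (show ((0 : Fin 2) : Fin 2) < 1 by decide)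
        ext i j; fin_cases i <;> fin_cases j <;> simp [hd01, hd10]
      -- `h w = u⁻¹ · (w d w⁻¹)` with both factors in `B(F)`
      have hwdw := coe_weyl_conj_diagonal_two hw hdmat
      have hmem : ((h * w).1 : GL (Fin 2) E) ∈ borelOfForm (c : E →+* E) 2 := by
        have e1 : h * w = u⁻¹ * (w * d * w⁻¹) := by
          rw [hddef]
          have e : u⁻¹ * (w * (w⁻¹ * u * h) * w⁻¹) = h * w⁻¹ := by group
          rw [e, weyl_inv_two hw]
        rw [e1]
        exact Subgroup.mul_mem _ (Subgroup.inv_mem _ (unipotentOfForm_le_borelOfForm hu))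
          (mem_borelOfForm_of_blockTriangular_two (by
            rw [hwdw]; intro i j hij
            fin_cases i <;> fin_cases j <;> first | exact absurd hij (by decide) | simp))
      exact hmem.2
  · rintro (hhB | hhwB)
    · have hmem : ((h * g₀ * h⁻¹).1 : GL (Fin 2) E) ∈ borelOfForm (c : E →+* E) 2 :=
        Subgroup.mul_mem _ (Subgroup.mul_mem _ (mem_borelOfForm_of_blockTriangular_two hhB) hg₀B)
          (Subgroup.inv_mem _ (mem_borelOfForm_of_blockTriangular_two hhB))
      exact hmem.2
    · have heq : h * g₀ * h⁻¹ = (h * w) * (w * g₀ * w⁻¹) * (h * w)⁻¹ := by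
        have e : (h * w) * (w * g₀ * w⁻¹) * (h * w)⁻¹ = h * (w * w) * g₀ * (w * w)⁻¹ * h⁻¹ := by group
        rw [e, weyl_mul_self_two hw, inv_one, mul_one, mul_one]
      rw [heq]
      have hmem : (((h * w) * (w * g₀ * w⁻¹) * (h * w)⁻¹).1 : GL (Fin 2) E) ∈ borelOfForm (c : E →+* E) 2 :=
        Subgroup.mul_mem _ (Subgroup.mul_mem _ (mem_borelOfForm_of_blockTriangular_two hhwB) hwg₀B)
          (Subgroup.inv_mem _ (mem_borelOfForm_of_blockTriangular_two hhwB))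
      exact hmem.2

end TwoBorels

/-! ## §6 In the letters of `G(F) ≤ G(𝔸_F)`: the two cosets of `B(F)∖G(F)` carrying a hyperbolic element -/

section Arithmetic

variable {F E : Type} [Field F] [NumberField F] [Field E] [NumberField E] [Algebra F E]
  {c : E ≃ₐ[F] E}

/-- The diagonal embedding `U(J₂)(F) → U(J₂)(𝔸_F)` is injective (`E → 𝔸_E` is). [folklore] -/
private theorem toAdelic_injective₂ : Function.Injective ((quasiSplit F E c 2).toAdelic) := by
  intro γ γ' h
  apply Subtype.ext
  apply Matrix.GeneralLinearGroup.ext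
  intro i j
  have hij := congrArg (fun g : (quasiSplit F E c 2).Adelic =>
    ((adelicVal F E c 2 _ g : GL (Fin 2) (AdeleRing (𝓞 E) E)) : Matrix (Fin 2) (Fin 2) (AdeleRing (𝓞 E) E)) i j) h
  exact AdeleRing.algebraMap_injective (𝓞 E) E hij

/-- **THE TWO RATIONAL BORELS, in `G(F)`** (rank one): for `γ♯ = ι(γ₀)`, `γ₀ = d(a, (ca)⁻¹)` regular
hyperbolic, `w♯ = ι(w)` and `δ ∈ G(F)`: `δ γ♯ δ⁻¹ ∈ B(F) ↔ δ ∈ B(F) ∨ δ w♯ ∈ B(F)`.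
[cite: Rogawski1990, §6.1 (pp. 79–80); §7.3 (p. 97)] [cite: Arthur1978TraceFormulaI, §8] -/
theorem conj_mem_arithmeticBorel_iff_of_hyperbolic_two (hc : c * c = 1) {a : Eˣ} (ha : c (a : E) * (a : E) ≠ 1)
    {g₀ w : (quasiSplit F E c 2).Rational}
    (hg₀ : ((g₀.1 : GL (Fin 2) E) : Matrix (Fin 2) (Fin 2) E) = !![(a : E), 0; 0, (c (a : E))⁻¹])
    (hw : ((w.1 : GL (Fin 2) E) : Matrix (Fin 2) (Fin 2) E) = !![(0 : E), 1; 1, 0])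
    (δ : (quasiSplit F E c 2).arithmeticSubgroup) :
    δ * ⟨(quasiSplit F E c 2).toAdelic g₀, g₀, rfl⟩ * δ⁻¹ ∈ arithmeticBorel F E c 2 ↔
      δ ∈ arithmeticBorel F E c 2 ∨ δ * ⟨(quasiSplit F E c 2).toAdelic w, w, rfl⟩ ∈ arithmeticBorel F E c 2 := by
  obtain ⟨h, hh⟩ := δ.2
  have e1 : ((δ * ⟨(quasiSplit F E c 2).toAdelic g₀, g₀, rfl⟩ * δ⁻¹ : (quasiSplit F E c 2).arithmeticSubgroup) :
      (quasiSplit F E c 2).Adelic) = (quasiSplit F E c 2).toAdelic (h * g₀ * h⁻¹) := by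
    rw [map_mul, map_mul, map_inv, hh]; rfl
  have e2 : ((δ : (quasiSplit F E c 2).arithmeticSubgroup) : (quasiSplit F E c 2).Adelic) = (quasiSplit F E c 2).toAdelic h :=
    hh.symm
  have e3 : ((δ * ⟨(quasiSplit F E c 2).toAdelic w, w, rfl⟩ : (quasiSplit F E c 2).arithmeticSubgroup) :
      (quasiSplit F E c 2).Adelic) = (quasiSplit F E c 2).toAdelic (h * w) := by
    rw [map_mul, hh]; rfl
  rw [mem_arithmeticBorel_iff, mem_arithmeticBorel_iff, mem_arithmeticBorel_iff, e1, e2, e3,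
    toAdelic_mem_borelAdelic_iff, toAdelic_mem_borelAdelic_iff, toAdelic_mem_borelAdelic_iff]
  exact conj_mem_borel_iff_of_hyperbolic_two hc ha hg₀ hw

/-- **The centraliser of `γ♯` in `G(F)` lies in `B(F)` and is normalised by `w♯` into `B(F)`** (rank one):
if `δ γ♯ = γ♯ δ` then `δ ∈ B(F)` and `w♯ δ w♯⁻¹ ∈ B(F)` (both are diagonal) — so the heights `H(δ y) = H(y)`
and `H(w♯ δ y) = H(w♯ y)` are `G_{γ}(F)`-invariant, as the weight `2T − H(x) − H(wx)` must be.
[cite: Rogawski1990, §3.6 (pp. 28–29); §6.1 (p. 80)] -/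
theorem mem_arithmeticBorel_of_commute_hyperbolic_two {a : Eˣ} (ha : c (a : E) * (a : E) ≠ 1)
    {g₀ w : (quasiSplit F E c 2).Rational}
    (hg₀ : ((g₀.1 : GL (Fin 2) E) : Matrix (Fin 2) (Fin 2) E) = !![(a : E), 0; 0, (c (a : E))⁻¹])
    (hw : ((w.1 : GL (Fin 2) E) : Matrix (Fin 2) (Fin 2) E) = !![(0 : E), 1; 1, 0])
    {δ : (quasiSplit F E c 2).arithmeticSubgroup}
    (hδ : δ * ⟨(quasiSplit F E c 2).toAdelic g₀, g₀, rfl⟩ = ⟨(quasiSplit F E c 2).toAdelic g₀, g₀, rfl⟩ * δ) :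
    δ ∈ arithmeticBorel F E c 2 ∧
      ⟨(quasiSplit F E c 2).toAdelic w, w, rfl⟩ * δ * (⟨(quasiSplit F E c 2).toAdelic w, w, rfl⟩)⁻¹ ∈ arithmeticBorel F E c 2 := by
  have haa' := ne_inv_conj_of_ne (F := F) ha
  obtain ⟨h, hh⟩ := δ.2
  have hcomm : h * g₀ = g₀ * h := by
    apply toAdelic_injective₂
    rw [map_mul, map_mul, hh]
    exact congrArg (fun x : (quasiSplit F E c 2).arithmeticSubgroup => (x : (quasiSplit F E c 2).Adelic)) hδ
  obtain ⟨hB, h01⟩ := blockTriangular_of_commute_regular_two hg₀ haa' hcomm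
  have hdmat : ((h.1 : GL (Fin 2) E) : Matrix (Fin 2) (Fin 2) E) =
      !![((h.1 : GL (Fin 2) E) : Matrix (Fin 2) (Fin 2) E) 0 0, 0; 0, ((h.1 : GL (Fin 2) E) : Matrix (Fin 2) (Fin 2) E) 1 1] := by
    have h10 : ((h.1 : GL (Fin 2) E) : Matrix (Fin 2) (Fin 2) E) 1 0 = 0 := hB (show ((0 : Fin 2) : Fin 2) < 1 by decide)
    ext i j; fin_cases i <;> fin_cases j <;> simp [h01, h10]
  have hwdw := coe_weyl_conj_diagonal_two hw hdmat
  have e2 : ((δ : (quasiSplit F E c 2).arithmeticSubgroup) : (quasiSplit F E c 2).Adelic) = (quasiSplit F E c 2).toAdelic h :=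
    hh.symm
  have e3 : ((⟨(quasiSplit F E c 2).toAdelic w, w, rfl⟩ * δ * (⟨(quasiSplit F E c 2).toAdelic w, w, rfl⟩)⁻¹ :
      (quasiSplit F E c 2).arithmeticSubgroup) : (quasiSplit F E c 2).Adelic) = (quasiSplit F E c 2).toAdelic (w * h * w⁻¹) := by
    rw [map_mul, map_mul, map_inv, hh]; rfl
  refine ⟨?_, ?_⟩
  · rw [mem_arithmeticBorel_iff, e2, toAdelic_mem_borelAdelic_iff]; exact hB
  · rw [mem_arithmeticBorel_iff, e3, toAdelic_mem_borelAdelic_iff, hwdw]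
    intro i j hij
    fin_cases i <;> fin_cases j <;> first | exact absurd hij (by decide) | simp

/-- `w♯ ∉ B(F)` in `G(F)`. [cite: Rogawski1990, §6.1 (p. 80)] -/
theorem mk_toAdelic_weyl_not_mem_arithmeticBorel_two {w : (quasiSplit F E c 2).Rational}
    (hw : ((w.1 : GL (Fin 2) E) : Matrix (Fin 2) (Fin 2) E) = !![(0 : E), 1; 1, 0]) :
    (⟨(quasiSplit F E c 2).toAdelic w, w, rfl⟩ : (quasiSplit F E c 2).arithmeticSubgroup) ∉ arithmeticBorel F E c 2 := by
  rw [mem_arithmeticBorel_iff]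
  exact toAdelic_weyl_not_mem_borelAdelic_two hw

/-- `w♯ · w♯ = 1` in `G(F)`. [cite: Rogawski1990, §6.1 (p. 80)] -/
theorem mk_toAdelic_weyl_mul_self_two {w : (quasiSplit F E c 2).Rational}
    (hw : ((w.1 : GL (Fin 2) E) : Matrix (Fin 2) (Fin 2) E) = !![(0 : E), 1; 1, 0]) :
    (⟨(quasiSplit F E c 2).toAdelic w, w, rfl⟩ : (quasiSplit F E c 2).arithmeticSubgroup) *
      ⟨(quasiSplit F E c 2).toAdelic w, w, rfl⟩ = 1 := by
  apply Subtype.ext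
  change (quasiSplit F E c 2).toAdelic w * (quasiSplit F E c 2).toAdelic w = 1
  rw [← map_mul, weyl_mul_self_two hw, map_one]

/-- **EXACTLY TWO COSETS OF `B(F)∖G(F)` CARRY A GIVEN HYPERBOLIC ELEMENT** (rank one): for
`γ′ = δ₀⁻¹ γ♯ δ₀` and a right coset `q ∈ B(F)∖G(F)` (with the representative `q.out` of ★ `pseudoEisenstein`),
`q.out γ′ q.out⁻¹ ∈ B(F)` iff `q = B(F)δ₀` or `q = B(F) w♯ δ₀` — the index set of the terms of
`K_{B,𝔬}(δx, δx)`, `δ ∈ B(F)∖G(F)`, containing `γ′`, whose cut-offs `1_{T<H(δ₀x)}`, `1_{T<H(w δ₀ x)}` assemble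
Arthur's weight `1 − τ̂(H(x) − T) − τ̂(H(wx) − T)` [Rogawski1990, (6.1.1)–(6.1.3)].
[cite: Rogawski1990, §6.1 (pp. 79–80); §7.3 (p. 97)] [cite: Arthur1978TraceFormulaI, §8] -/
theorem out_conj_mem_arithmeticBorel_iff_of_hyperbolic_two (hc : c * c = 1) {a : Eˣ} (ha : c (a : E) * (a : E) ≠ 1)
    {g₀ w : (quasiSplit F E c 2).Rational}
    (hg₀ : ((g₀.1 : GL (Fin 2) E) : Matrix (Fin 2) (Fin 2) E) = !![(a : E), 0; 0, (c (a : E))⁻¹])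
    (hw : ((w.1 : GL (Fin 2) E) : Matrix (Fin 2) (Fin 2) E) = !![(0 : E), 1; 1, 0])
    (δ₀ : (quasiSplit F E c 2).arithmeticSubgroup) (q : Quotient (QuotientGroup.rightRel (arithmeticBorel F E c 2))) :
    q.out * (δ₀⁻¹ * ⟨(quasiSplit F E c 2).toAdelic g₀, g₀, rfl⟩ * δ₀) * q.out⁻¹ ∈ arithmeticBorel F E c 2 ↔
      q = Quotient.mk (QuotientGroup.rightRel (arithmeticBorel F E c 2)) δ₀ ∨
      q = Quotient.mk (QuotientGroup.rightRel (arithmeticBorel F E c 2)) (⟨(quasiSplit F E c 2).toAdelic w, w, rfl⟩ * δ₀) := by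
  set γ := (⟨(quasiSplit F E c 2).toAdelic g₀, g₀, rfl⟩ : (quasiSplit F E c 2).arithmeticSubgroup) with hγ
  set ws := (⟨(quasiSplit F E c 2).toAdelic w, w, rfl⟩ : (quasiSplit F E c 2).arithmeticSubgroup) with hws
  have hrw : q.out * (δ₀⁻¹ * γ * δ₀) * q.out⁻¹ = (q.out * δ₀⁻¹) * γ * (q.out * δ₀⁻¹)⁻¹ := by group
  rw [hrw, conj_mem_arithmeticBorel_iff_of_hyperbolic_two hc ha hg₀ hw (q.out * δ₀⁻¹)]
  have hws2 : ws * ws = 1 := mk_toAdelic_weyl_mul_self_two hw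
  have hwsinv : ws⁻¹ = ws := inv_eq_of_mul_eq_one_right hws2
  -- `q = B δ ↔ q.out δ⁻¹ ∈ B`
  have key : ∀ δ : (quasiSplit F E c 2).arithmeticSubgroup,
      q = Quotient.mk (QuotientGroup.rightRel (arithmeticBorel F E c 2)) δ ↔ q.out * δ⁻¹ ∈ arithmeticBorel F E c 2 := by
    intro δ
    conv_lhs => rw [← Quotient.out_eq q]
    rw [Quotient.eq, QuotientGroup.rightRel_apply]
    constructor
    · intro h; have h' := Subgroup.inv_mem _ h; rwa [_root_.mul_inv_rev, inv_inv] at h'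
    · intro h; have h' := Subgroup.inv_mem _ h; rwa [_root_.mul_inv_rev, inv_inv] at h'
  rw [key δ₀, key (ws * δ₀), _root_.mul_inv_rev, hwsinv, ← mul_assoc]

/-- The two cosets are DISTINCT (`w♯ ∉ B(F)`). [cite: Rogawski1990, §6.1 (p. 80)] -/
theorem mk_ne_mk_weyl_mul_two {w : (quasiSplit F E c 2).Rational}
    (hw : ((w.1 : GL (Fin 2) E) : Matrix (Fin 2) (Fin 2) E) = !![(0 : E), 1; 1, 0])
    (δ₀ : (quasiSplit F E c 2).arithmeticSubgroup) :
    Quotient.mk (QuotientGroup.rightRel (arithmeticBorel F E c 2)) δ₀ ≠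
      Quotient.mk (QuotientGroup.rightRel (arithmeticBorel F E c 2)) (⟨(quasiSplit F E c 2).toAdelic w, w, rfl⟩ * δ₀) := by
  intro h
  rw [Quotient.eq, QuotientGroup.rightRel_apply, mul_inv_cancel_right] at h
  exact mk_toAdelic_weyl_not_mem_arithmeticBorel_two hw h

end Arithmetic

/-! ## §7 Representatives: the hyperbolic diagonal, and conjugation onto `γ♯` -/

section OneClass

variable {F E : Type} [Field F] [NumberField F] [Field E] [NumberField E] [Algebra F E]
  {c : E ≃ₐ[F] E}

/-- **`γ₀ = d(a, (ca)⁻¹) ∈ U(J₂)(F)`** for every `a ∈ Eˣ` (★ `glDiagonal_mem_rational_of_diag`).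
[cite: Rogawski1990, §1.10; §7.3 (p. 97)] -/
theorem exists_rational_eq_hyperbolicDiagonal_two (hc : c * c = 1) (a : Eˣ) :
    ∃ g₀ : (quasiSplit F E c 2).Rational,
      ((g₀.1 : GL (Fin 2) E) : Matrix (Fin 2) (Fin 2) E) = !![(a : E), 0; 0, (c (a : E))⁻¹] := by
  have ha0 : c (a : E) ≠ 0 := by rw [map_ne_zero_iff _ c.injective]; exact a.ne_zero
  set a' : Eˣ := Units.mk0 (c (a : E))⁻¹ (inv_ne_zero ha0) with ha'
  set d : Fin 2 → Eˣ := ![a, a'] with hdd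
  have hd : ∀ i, c (d (Fin.rev i) : E) * (d i : E) = 1 := by
    intro i
    fin_cases i
    · change c (a' : E) * (a : E) = 1
      rw [ha', Units.val_mk0, map_inv₀, conj_conj₂ hc, inv_mul_cancel₀ a.ne_zero]
    · change c (a : E) * (a' : E) = 1
      rw [ha', Units.val_mk0, mul_inv_cancel₀ ha0]
  refine ⟨⟨glDiagonal 2 E d, glDiagonal_mem_rational_of_diag (F := F) d hd⟩, ?_⟩
  change ((glDiagonal 2 E d : GL (Fin 2) E) : Matrix (Fin 2) (Fin 2) E) = _
  rw [coe_glDiagonal]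
  ext i j; fin_cases i <;> fin_cases j <;> simp [hdd, ha']

/-- **Every rational Borel element of the class is `N(F)`-conjugate to `γ₀` or to `γ₀^w = w γ₀ w⁻¹`**
(§3 + §4). [cite: Rogawski1990, §6.1 (pp. 79–80); §7.3 (p. 97)] -/
theorem exists_unipotent_conj_eq_or_of_hyperbolic_two (hc : c * c = 1) {a : Eˣ} (ha : c (a : E) * (a : E) ≠ 1)
    {β : (quasiSplit F E c 2).Rational}
    (hB : (((β.1 : GL (Fin 2) E) : Matrix (Fin 2) (Fin 2) E)).BlockTriangular id)
    (hp : (((β.1 : GL (Fin 2) E) : Matrix (Fin 2) (Fin 2) E)).charpoly = (X - C (a : E)) * (X - C (c (a : E))⁻¹)) :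
    ∃ u : (quasiSplit F E c 2).Rational, (u.1 : GL (Fin 2) E) ∈ unipotentOfForm (c : E →+* E) 2 ∧
      ((((u * β * u⁻¹).1 : GL (Fin 2) E) : Matrix (Fin 2) (Fin 2) E) = !![(a : E), 0; 0, (c (a : E))⁻¹] ∨
       (((u * β * u⁻¹).1 : GL (Fin 2) E) : Matrix (Fin 2) (Fin 2) E) = !![(c (a : E))⁻¹, 0; 0, (a : E)]) := by
  have haa' := ne_inv_conj_of_ne (F := F) ha
  have h10 : ((β.1 : GL (Fin 2) E) : Matrix (Fin 2) (Fin 2) E) 1 0 = 0 := hB (show ((0 : Fin 2) : Fin 2) < 1 by decide)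
  rcases diag_eq_or_of_blockTriangular_of_charpoly_eq_hyperbolic_two hc hB hp with ⟨h00, h11⟩ | ⟨h00, h11⟩
  · have hβmat : ((β.1 : GL (Fin 2) E) : Matrix (Fin 2) (Fin 2) E) =
        !![(a : E), ((β.1 : GL (Fin 2) E) : Matrix (Fin 2) (Fin 2) E) 0 1; 0, (c (a : E))⁻¹] := by
      ext i j; fin_cases i <;> fin_cases j <;> simp [h00, h11, h10]
    obtain ⟨u, hu, huβ⟩ := exists_unipotent_conj_eq_diagonal_two hβmat haa'
    exact ⟨u, hu, Or.inl huβ⟩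
  · have hβmat : ((β.1 : GL (Fin 2) E) : Matrix (Fin 2) (Fin 2) E) =
        !![(c (a : E))⁻¹, ((β.1 : GL (Fin 2) E) : Matrix (Fin 2) (Fin 2) E) 0 1; 0, (a : E)] := by
      ext i j; fin_cases i <;> fin_cases j <;> simp [h00, h11, h10]
    obtain ⟨u, hu, huβ⟩ := exists_unipotent_conj_eq_diagonal_two hβmat haa'.symm
    exact ⟨u, hu, Or.inr huβ⟩

/-- **An element of the regular hyperbolic class that is conjugate INTO `B(F)` is conjugate to `γ♯`**:
for `γ ∈ G(F)` with characteristic-polynomial class `((X − a)(X − (ca)⁻¹)) ⊗ 𝔸_E` (`c a · a ≠ 1`) and some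
`δ ∈ G(F)` with `δ γ δ⁻¹ ∈ B(F)` (the «classes meeting `B(F)` live in rational Borels» letter of the
sequel), `γ` is `G(F)`-conjugate to `γ♯ = ι(d(a, (ca)⁻¹))` — §7 (to `γ₀` or `γ₀^w`), then `w`. So the class
is ONE `G(F)`-conjugacy class and `K_𝔬(x,x) = Σ_{δ ∈ G_γ(F)∖G(F)} f(x⁻¹ δ⁻¹ γ♯ δ x)` [Rogawski1990, §6.1
(6.1.1)]. [cite: Rogawski1990, §6.1 (pp. 79–80); §7.3 (p. 97)] [cite: Arthur1978TraceFormulaI, §8] -/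
theorem exists_conj_eq_mk_toAdelic_of_conj_mem_arithmeticBorel_two (hc : c * c = 1) {a : Eˣ}
    (ha : c (a : E) * (a : E) ≠ 1) {g₀ w : (quasiSplit F E c 2).Rational}
    (hg₀ : ((g₀.1 : GL (Fin 2) E) : Matrix (Fin 2) (Fin 2) E) = !![(a : E), 0; 0, (c (a : E))⁻¹])
    (hw : ((w.1 : GL (Fin 2) E) : Matrix (Fin 2) (Fin 2) E) = !![(0 : E), 1; 1, 0])
    {γ : (quasiSplit F E c 2).arithmeticSubgroup}
    (hγ : ((adelicVal F E c 2 _ (γ : (quasiSplit F E c 2).Adelic) : GL (Fin 2) (AdeleRing (𝓞 E) E)) :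
        Matrix (Fin 2) (Fin 2) (AdeleRing (𝓞 E) E)).charpoly =
      ((X - C (a : E)) * (X - C (c (a : E))⁻¹)).map (algebraMap E (AdeleRing (𝓞 E) E)))
    (hδB : ∃ δ : (quasiSplit F E c 2).arithmeticSubgroup, δ * γ * δ⁻¹ ∈ arithmeticBorel F E c 2) :
    ∃ δ : (quasiSplit F E c 2).arithmeticSubgroup, δ * γ * δ⁻¹ = ⟨(quasiSplit F E c 2).toAdelic g₀, g₀, rfl⟩ := by
  obtain ⟨δ, hδB⟩ := hδB
  obtain ⟨β₀, hβ₀⟩ := (δ * γ * δ⁻¹).2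
  have hB : (((β₀.1 : GL (Fin 2) E) : Matrix (Fin 2) (Fin 2) E)).BlockTriangular id := by
    refine (toAdelic_mem_borelAdelic_iff β₀).1 ?_
    rw [hβ₀]
    exact (mem_arithmeticBorel_iff _).1 hδB
  have hp : (((β₀.1 : GL (Fin 2) E) : Matrix (Fin 2) (Fin 2) E)).charpoly = (X - C (a : E)) * (X - C (c (a : E))⁻¹) := by
    apply Polynomial.map_injective _ (AdeleRing.algebraMap_injective (𝓞 E) E)
    have hci : ((adelicVal F E c 2 _ ((δ * γ * δ⁻¹ : (quasiSplit F E c 2).arithmeticSubgroup) :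
        (quasiSplit F E c 2).Adelic) : GL (Fin 2) (AdeleRing (𝓞 E) E)) : Matrix (Fin 2) (Fin 2) (AdeleRing (𝓞 E) E)).charpoly =
        ((adelicVal F E c 2 _ (γ : (quasiSplit F E c 2).Adelic) : GL (Fin 2) (AdeleRing (𝓞 E) E)) :
          Matrix (Fin 2) (Fin 2) (AdeleRing (𝓞 E) E)).charpoly :=
      isConjInvariant_charpoly_adelicVal γ δ
    rw [← charpoly_adelicVal_toAdelic, hβ₀, hci, hγ]
  obtain ⟨u, -, hu⟩ := exists_unipotent_conj_eq_or_of_hyperbolic_two hc ha hB hp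
  -- the rational element `r` with `r β₀ r⁻¹ = γ₀`: `u` or `w⁻¹ u`
  obtain ⟨r, hr⟩ : ∃ r : (quasiSplit F E c 2).Rational, r * β₀ * r⁻¹ = g₀ := by
    rcases hu with hu | hu
    · refine ⟨u, ?_⟩
      apply Subtype.ext; apply Units.ext; rw [hu, hg₀]
    · refine ⟨w⁻¹ * u, ?_⟩
      -- `w⁻¹ (u β₀ u⁻¹) w = w⁻¹ (w γ₀ w⁻¹) w = γ₀`
      have hwg := coe_weyl_conj_diagonal_two hw hg₀
      have e1 : u * β₀ * u⁻¹ = w * g₀ * w⁻¹ := by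
        apply Subtype.ext; apply Units.ext; rw [hu, hwg]
      have e2 : w⁻¹ * u * β₀ * (w⁻¹ * u)⁻¹ = w⁻¹ * (u * β₀ * u⁻¹) * w := by group
      rw [e2, e1]; group
  refine ⟨⟨(quasiSplit F E c 2).toAdelic r, r, rfl⟩ * δ, ?_⟩
  apply Subtype.ext
  have e3 : ((⟨(quasiSplit F E c 2).toAdelic r, r, rfl⟩ * δ * γ * (⟨(quasiSplit F E c 2).toAdelic r, r, rfl⟩ * δ)⁻¹ :
      (quasiSplit F E c 2).arithmeticSubgroup) : (quasiSplit F E c 2).Adelic) =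
      (quasiSplit F E c 2).toAdelic r * ((δ * γ * δ⁻¹ : (quasiSplit F E c 2).arithmeticSubgroup) :
        (quasiSplit F E c 2).Adelic) * ((quasiSplit F E c 2).toAdelic r)⁻¹ := by
    simp only [Subgroup.coe_mul, Subgroup.coe_inv, _root_.mul_inv_rev, mul_assoc]
  rw [e3, ← hβ₀, ← map_inv, ← map_mul, ← map_mul, hr]

end OneClass

end UnitaryGroup

end Literature.NumberTheory.Automorphic
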